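import Mathlib
import Summits.ValiantsHypothesis.ValiantsHypothesis.Theorems.LacunarySymmetroidMatrixDescartesCensusDefs
import Summits.ValiantsHypothesis.ValiantsHypothesis.Theorems.LacunarySymmetroidMatrixDescartesCensusRealExpKit

/-!
# `MatrixDescartes` census — real-exponent pencils: Leibniz expansion, distinct exponents, persistent sign brackets

HONEST FRAMING.  Object-search cell `pub-symmetroid`, items `DoorA26 = PosRootLawAt 2 6 19`
(stmt-ValiantsHypothesis-19979) and `DoorA34 = PosRootLawAt 3 4 18` (stmt-ValiantsHypothesis-19980),
both OPEN, typed, never asserted.  This file is the pencil-side toolkit of the reduction of the two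
doors to REAL exponent vectors (companion `…CensusRealExponentsDoors`: `posRootLawAt_iff_rpow`,
`doorA26_iff_rpow`, `doorA34_iff_rpow`, openness of the residue); it decides nothing.  Nothing here
bears on `MatrixDescartes` (stmt-ValiantsHypothesis-18050) or on `VP ≠ VNP`.

WHY (seat val-sym-door-p1, report DOOR-A-P1-REPORT §1/§10/§22).  The positive-root count of
`det ∑ X^{d_l} S_l` is invariant under `d ↦ g·d` (`x ↦ x^{1/g}`), so the honest parameter space of an
«all-supports» row is the set of REAL exponent vectors `δ : Fin K → ℝ` (pencils `∑_l x^{δ_l} S_l`,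
`x > 0`, real powers), and «a twenty anywhere gives twenties on an open set of real supports, hence on
integer supports of every large denominator».  The kernel form of that sentence needs:

* `det_expPencil_eq_expSum` — in the variable `t = log x` the determinant of a real-exponent `m × m`
  pencil with `K` letters is a real exponential sum indexed by `Perm(m) × (Fin m → Fin K)` with
  exponents the `m`-fold sums `∑_i δ_{λ i}` (Leibniz);
* `card_image_sums_le` — its DISTINCT exponents number at most `#{monotone λ : Fin m → Fin K}`
  (`= C(m+K−1, m)`: `21` at `(2,6)`, `20` at `(3,4)`);
* `det_rpowPencil_eq`, `ncard_rpow_eq_ncard_exp` — `x^{δ} = e^{δ log x}`; the zero sets in `x > 0`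
  and in `t` have the same `Set.ncard`;
* `exists_nat_support` — clearing ONE denominator: for `δ' = z/D` (`z ∈ ℤ^K`) the integer support
  `e = z + M` (`M = ∑|z_l|`) satisfies `det ∑ X^{e_l} S_l (e^{t/D}) = 0 ↔ det ∑ e^{δ'_l t} S_l = 0`;
* `exists_persistent_brackets` — **the heart**: for a SHARP bound (`#{monotone λ} ≤ B + 2`) a
  real-exponent pencil with `≥ B + 1` zeros has a finite zero set of SIMPLE zeros (kit:
  `expSum_deriv_ne_zero_of_sharp`), hence `n ≥ B + 1` disjoint sign-change brackets which persist
  for every exponent vector in a ball around `δ` (continuity in `δ` at `2n` points);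
* `le_ncard_of_brackets` — brackets give back `≥ n` zeros (IVT) and a finite zero set (Laguerre).

[folklore] Leibniz expansion; Laguerre's count for real exponential sums (tree:
`Literature.Analysis.Approximation.Braess1986_VI_1_1_proper_holds`); Rolle; intermediate value
theorem.
-/

-- `Summit.ValiantsHypothesis.ValiantsHypothesis.…` repeats a component by the D-0017 layout
-- (single-conjunct summit), which the `dupNamespace` linter flags; the name is mandated.
set_option linter.dupNamespace false

namespace Summit.ValiantsHypothesis.ValiantsHypothesis.Theorems.LacunarySymmetroidMatrixDescartes.Census.RealExp

open Finset Filter Topology Polynomial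
open scoped BigOperators Matrix
open Summit.ValiantsHypothesis.ValiantsHypothesis.Theorems.MatrixDescartes.Negative (PosRootLawAt)
open Summit.ValiantsHypothesis.ValiantsHypothesis.Theorems.SymmetroidDescartes (eval_det_pencil)

section Expansion

variable {m K : ℕ}

/-- **Leibniz in the variable `t = log x`.**  The determinant of the real-exponent pencil
`∑_l e^{δ_l t} S_l` is the real exponential sum over `(σ, λ) ∈ Perm(m) × (Fin m → Fin K)` with
coefficients `sgn σ · ∏_i (S_{λ i})_{σ i, i}` and exponents `∑_i δ_{λ i}`. [folklore] -/
theorem det_expPencil_eq_expSum (δ : Fin K → ℝ) (S : Fin K → Matrix (Fin m) (Fin m) ℝ) (t : ℝ) :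
    (∑ l, Real.exp (δ l * t) • S l).det =
      ∑ p : Equiv.Perm (Fin m) × (Fin m → Fin K),
        (((Equiv.Perm.sign p.1 : ℤ) : ℝ) * ∏ i, S (p.2 i) (p.1 i) i) *
          Real.exp ((∑ i, δ (p.2 i)) * t) := by
  classical
  rw [Matrix.det_apply', Fintype.sum_prod_type]
  refine Finset.sum_congr rfl fun σ _ => ?_
  have h1 : ∀ i, (∑ l, Real.exp (δ l * t) • S l) (σ i) i = ∑ l, Real.exp (δ l * t) * S l (σ i) i := by
    intro i
    simp only [Matrix.sum_apply, Matrix.smul_apply, smul_eq_mul]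
  simp_rw [h1]
  rw [Fintype.prod_sum, Finset.mul_sum]
  refine Finset.sum_congr rfl fun lam _ => ?_
  rw [Finset.prod_mul_distrib, ← Real.exp_sum, Finset.sum_mul]
  ring

/-- **Distinct exponents.**  The `m`-fold sums `∑_i δ_{λ i}` over all `(σ, λ)` take at most
`#{λ : Fin m → Fin K monotone}` distinct values (sort `λ`). [folklore] -/
theorem card_image_sums_le (δ : Fin K → ℝ) :
    (univ.image (fun p : Equiv.Perm (Fin m) × (Fin m → Fin K) => ∑ i, δ (p.2 i))).card ≤
      (univ.filter (fun lam : Fin m → Fin K => Monotone lam)).card := by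
  classical
  have hsub : univ.image (fun p : Equiv.Perm (Fin m) × (Fin m → Fin K) => ∑ i, δ (p.2 i)) ⊆
      (univ.filter (fun lam : Fin m → Fin K => Monotone lam)).image (fun lam => ∑ i, δ (lam i)) := by
    intro y hy
    rw [Finset.mem_image] at hy ⊢
    obtain ⟨p, -, rfl⟩ := hy
    refine ⟨p.2 ∘ (Tuple.sort p.2), ?_, ?_⟩
    · rw [Finset.mem_filter]; exact ⟨mem_univ _, Tuple.monotone_sort p.2⟩
    · exact Equiv.sum_comp (Tuple.sort p.2) (fun i => δ (p.2 i))
  exact (Finset.card_le_card hsub).trans Finset.card_image_le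

/-- The real-exponent pencil determinant `t ↦ det ∑_l e^{δ_l t} S_l` is continuous in `t`.
[folklore] -/
theorem continuous_det_expPencil (δ : Fin K → ℝ) (S : Fin K → Matrix (Fin m) (Fin m) ℝ) :
    Continuous fun t : ℝ => (∑ l, Real.exp (δ l * t) • S l).det :=
  Continuous.matrix_det <| continuous_finsetSum _ fun _ _ =>
    ((continuous_const.mul continuous_id).rexp).smul continuous_const

/-- For fixed `t`, the determinant `δ ↦ det ∑_l e^{δ_l t} S_l` is continuous in the exponent
vector `δ ∈ ℝ^K`. [folklore] -/
theorem continuous_det_expPencil_exponents (S : Fin K → Matrix (Fin m) (Fin m) ℝ) (t : ℝ) :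
    Continuous fun δ : Fin K → ℝ => (∑ l, Real.exp (δ l * t) • S l).det :=
  Continuous.matrix_det <| continuous_finsetSum _ fun l _ =>
    (((continuous_apply l).mul continuous_const).rexp).smul continuous_const

/-- Real powers versus the variable `t = log x`: for `x > 0`,
`det ∑_l x^{δ_l} S_l = det ∑_l e^{δ_l log x} S_l`. [folklore] -/
theorem det_rpowPencil_eq (δ : Fin K → ℝ) (S : Fin K → Matrix (Fin m) (Fin m) ℝ) {x : ℝ}
    (hx : 0 < x) :
    (∑ l, (x ^ (δ l)) • S l).det = (∑ l, Real.exp (δ l * Real.log x) • S l).det := by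
  refine congrArg Matrix.det (Finset.sum_congr rfl fun l _ => ?_)
  rw [Real.rpow_def_of_pos hx, mul_comm]

/-- **Clearing one denominator.**  For exponents `δ'_l = z_l / D` (`z_l ∈ ℤ`, `D ≥ 1`) there is an
INTEGER support `e` (namely `e_l = z_l + M`, `M = ∑ |z_l|`) such that, along `x = e^{t/D}`, the
integer pencil `∑ X^{e_l} S_l` vanishes at `x` iff the real-exponent pencil `∑ e^{δ'_l t} S_l`
vanishes at `t` (`x^{e_l} = e^{M t / D} · e^{δ'_l t}` and `det` is homogeneous). [folklore] -/
theorem exists_nat_support (z : Fin K → ℤ) {D : ℕ} (hD : 0 < D) (S : Fin K → Matrix (Fin m) (Fin m) ℝ) :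
    ∃ e : Fin K → ℕ, ∀ t : ℝ,
      ((∑ l, (X : ℝ[X]) ^ e l • (S l).map C).det).eval (Real.exp (t / D)) = 0 ↔
        (∑ l, Real.exp (((z l : ℝ) / D) * t) • S l).det = 0 := by
  classical
  set M : ℤ := ∑ l, |z l| with hM
  have hnonneg : ∀ l, 0 ≤ z l + M := by
    intro l
    have h1 : |z l| ≤ M := by
      rw [hM]
      exact Finset.single_le_sum (f := fun l => |z l|) (fun l _ => abs_nonneg (z l)) (mem_univ l)
    have h2 : -|z l| ≤ z l := neg_abs_le (z l)
    linarith
  refine ⟨fun l => (z l + M).toNat, fun t => ?_⟩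
  have hD' : (D : ℝ) ≠ 0 := by exact_mod_cast hD.ne'
  have hpow : ∀ l, Real.exp (t / D) ^ (z l + M).toNat =
      Real.exp ((M : ℝ) * (t / D)) * Real.exp (((z l : ℝ) / D) * t) := by
    intro l
    rw [← Real.exp_nat_mul, ← Real.exp_add]
    congr 1
    have : (((z l + M).toNat : ℕ) : ℝ) = (z l : ℝ) + M := by
      have h := Int.toNat_of_nonneg (hnonneg l)
      exact_mod_cast h
    rw [this]
    field_simp
    ring
  rw [eval_det_pencil]
  have hsum : (∑ l, Real.exp (t / D) ^ (z l + M).toNat • S l) =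
      Real.exp ((M : ℝ) * (t / D)) • ∑ l, Real.exp (((z l : ℝ) / D) * t) • S l := by
    rw [Finset.smul_sum]
    refine Finset.sum_congr rfl fun l _ => ?_
    rw [hpow l, smul_smul]
  rw [hsum, Matrix.det_smul, Fintype.card_fin]
  constructor
  · intro h
    rcases mul_eq_zero.mp h with h | h
    · exact absurd h (pow_ne_zero _ (Real.exp_pos _).ne')
    · exact h
  · intro h
    rw [h, mul_zero]

end Expansion

section Brackets

variable {m K : ℕ}

/-- **The variable `t = log x`.**  The positive zeros of the real-exponent pencil determinant
`x ↦ det ∑_l x^{δ_l} S_l` and the real zeros of `t ↦ det ∑_l e^{δ_l t} S_l` correspond under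
`x = e^t`; in particular the two zero sets have the same `Set.ncard`. [folklore] -/
theorem ncard_rpow_eq_ncard_exp (δ : Fin K → ℝ) (S : Fin K → Matrix (Fin m) (Fin m) ℝ) :
    {x : ℝ | 0 < x ∧ (∑ l, (x ^ (δ l)) • S l).det = 0}.ncard =
      {t : ℝ | (∑ l, Real.exp (δ l * t) • S l).det = 0}.ncard := by
  have hZ : Real.exp '' {t : ℝ | (∑ l, Real.exp (δ l * t) • S l).det = 0} =
      {x : ℝ | 0 < x ∧ (∑ l, (x ^ (δ l)) • S l).det = 0} := by
    ext x
    constructor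
    · rintro ⟨t, ht, rfl⟩
      refine ⟨Real.exp_pos t, ?_⟩
      rw [det_rpowPencil_eq δ S (Real.exp_pos t), Real.log_exp]
      exact ht
    · rintro ⟨hx, h0⟩
      refine ⟨Real.log x, ?_, Real.exp_log hx⟩
      rw [Set.mem_setOf_eq]
      rw [det_rpowPencil_eq δ S hx] at h0
      exact h0
  rw [← hZ, Set.ncard_image_of_injective _ Real.exp_injective]

/-- **Persistent sign brackets (the heart of the reduction).**  Let the bound be sharp
(`#{λ : Fin m → Fin K monotone} ≤ B + 2`) and let the real-exponent pencil `∑_l e^{δ_l t} S_l` have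
at least `B + 1` zeros in `t` (as `Set.ncard`).  Then its zero set is finite of some size
`n ≥ B + 1`, every zero is SIMPLE (kit: `expSum_deriv_ne_zero_of_sharp`), and there are `n` pairwise
disjoint, increasing brackets `a i < b i` and a radius `r > 0` such that for EVERY exponent vector
`δ'` with `dist δ' δ < r` the determinant `det ∑_l e^{δ'_l t} S_l` takes values of opposite signs at
`a i` and `b i` (continuity in `δ'` at the `2n` bracket points). [folklore] -/
theorem exists_persistent_brackets {B : ℕ}
    (hB : (univ.filter (fun lam : Fin m → Fin K => Monotone lam)).card ≤ B + 2)
    (δ : Fin K → ℝ) (S : Fin K → Matrix (Fin m) (Fin m) ℝ)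
    (hcount : B + 1 ≤ {t : ℝ | (∑ l, Real.exp (δ l * t) • S l).det = 0}.ncard) :
    ∃ n : ℕ, B + 1 ≤ n ∧ ∃ a b : Fin n → ℝ, (∀ i, a i < b i) ∧ (∀ i j, i < j → b i < a j) ∧
      ∃ r : ℝ, 0 < r ∧ ∀ δ' : Fin K → ℝ, dist δ' δ < r → ∀ i,
        (∑ l, Real.exp (δ' l * a i) • S l).det * (∑ l, Real.exp (δ' l * b i) • S l).det < 0 := by
  classical
  set G : ℝ → ℝ := fun t => (∑ l, Real.exp (δ l * t) • S l).det with hG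
  set Zt : Set ℝ := {t | G t = 0} with hZt
  change B + 1 ≤ Zt.ncard at hcount
  -- `G` as an exponential sum
  set α : Equiv.Perm (Fin m) × (Fin m → Fin K) → ℝ :=
    fun p => ((Equiv.Perm.sign p.1 : ℤ) : ℝ) * ∏ i, S (p.2 i) (p.1 i) i with hα
  set s : Equiv.Perm (Fin m) × (Fin m → Fin K) → ℝ := fun p => ∑ i, δ (p.2 i) with hs
  have hGsum : ∀ t, G t = ∑ p, α p * Real.exp (s p * t) := fun t => det_expPencil_eq_expSum δ S t
  have hZt' : Zt = {t | ∑ p, α p * Real.exp (s p * t) = 0} := by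
    ext t; rw [hZt, Set.mem_setOf_eq, Set.mem_setOf_eq, hGsum]
  have hk : (univ.image s).card ≤ B + 2 := (card_image_sums_le δ).trans hB
  -- `G ≢ 0` (else the zero set is all of `ℝ`, of `ncard` zero)
  have hne : ∃ t, ∑ p, α p * Real.exp (s p * t) ≠ 0 := by
    by_contra h
    push Not at h
    have huniv : Zt = Set.univ := by
      rw [hZt']; exact Set.eq_univ_iff_forall.mpr h
    rw [huniv, Set.infinite_univ.ncard] at hcount
    omega
  have hfin : Zt.Finite := by
    rcases expSum_zero_or_ncard_le α s with h | h
    · obtain ⟨t, ht⟩ := hne; exact absurd (h t) ht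
    · rw [hZt']; exact h.1
  -- every zero is simple (sharpness)
  have hsimple : ∀ t, G t = 0 → ∑ p, α p * (s p * Real.exp (s p * t)) ≠ 0 := by
    intro t ht
    refine expSum_deriv_ne_zero_of_sharp α s hne ?_ (by rw [← hGsum]; exact ht)
    rw [← hZt']
    omega
  -- sort the zeros and bracket them
  obtain ⟨Zf, hZfmem⟩ : ∃ Zf : Finset ℝ, ∀ x, x ∈ Zf ↔ x ∈ Zt :=
    ⟨hfin.toFinset, fun x => hfin.mem_toFinset⟩
  have hZfeq : (↑Zf : Set ℝ) = Zt := Set.ext fun x => hZfmem x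
  set n : ℕ := Zf.card with hn
  have hnZ : Zt.ncard = n := by rw [← hZfeq, Set.ncard_coe_finset]
  have hnB : B + 1 ≤ n := by rw [← hnZ]; exact hcount
  set g := Zf.orderEmbOfFin rfl with hg
  have hgmono : StrictMono g := (Zf.orderEmbOfFin rfl).strictMono
  have hgzero : ∀ i, G (g i) = 0 := fun i => (hZfmem _).mp (Finset.orderEmbOfFin_mem Zf rfl i)
  have hgzero' : ∀ i, ∑ p, α p * Real.exp (s p * g i) = 0 := fun i => by
    rw [← hGsum]; exact hgzero i
  obtain ⟨a, b, hab, hdisj, hsign⟩ := exists_brackets (hasDerivAt_expSum α s) hgmono hgzero'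
    (fun i => hsimple (g i) (hgzero i))
  have hsignG : ∀ i, G (a i) * G (b i) < 0 := fun i => by rw [hGsum, hGsum]; exact hsign i
  -- the brackets persist on a neighbourhood of `δ` in `ℝ^K`
  set U : Set (Fin K → ℝ) := {δ' | ∀ i, (∑ l, Real.exp (δ' l * a i) • S l).det *
    (∑ l, Real.exp (δ' l * b i) • S l).det < 0} with hU
  have hUopen : IsOpen U := by
    have : U = ⋂ i, {δ' : Fin K → ℝ | (∑ l, Real.exp (δ' l * a i) • S l).det *
        (∑ l, Real.exp (δ' l * b i) • S l).det < 0} := by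
      rw [hU]; ext δ'; simp only [Set.mem_setOf_eq, Set.mem_iInter]
    rw [this]
    exact isOpen_iInter_of_finite fun i =>
      isOpen_lt ((continuous_det_expPencil_exponents S (a i)).mul
        (continuous_det_expPencil_exponents S (b i))) continuous_const
  have hδU : δ ∈ U := by rw [hU]; exact hsignG
  obtain ⟨r, hr, hball⟩ := Metric.isOpen_iff.mp hUopen δ hδU
  refine ⟨n, hnB, a, b, fun i => (hab i).1.trans (hab i).2, hdisj, r, hr, fun δ' hδ' => ?_⟩
  have h := hball (Metric.mem_ball.mpr hδ')
  rw [hU, Set.mem_setOf_eq] at h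
  exact h

/-- **From brackets to zeros.**  If `det ∑_l e^{δ'_l t} S_l` changes sign across `n ≥ 1` pairwise
disjoint increasing brackets, then its zero set is finite with at least `n` elements (one zero per
bracket by the intermediate value theorem; finiteness by Laguerre, the function not being identically
zero since it is non-zero at a bracket end). [folklore] -/
theorem le_ncard_of_brackets (δ' : Fin K → ℝ) (S : Fin K → Matrix (Fin m) (Fin m) ℝ) {n : ℕ}
    (hn : 0 < n) {a b : Fin n → ℝ} (hab : ∀ i, a i < b i) (hdisj : ∀ i j, i < j → b i < a j)
    (hsign : ∀ i, (∑ l, Real.exp (δ' l * a i) • S l).det *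
      (∑ l, Real.exp (δ' l * b i) • S l).det < 0) :
    {t : ℝ | (∑ l, Real.exp (δ' l * t) • S l).det = 0}.Finite ∧
      n ≤ {t : ℝ | (∑ l, Real.exp (δ' l * t) • S l).det = 0}.ncard := by
  classical
  have hzeros : ∀ i, ∃ w ∈ Set.Ioo (a i) (b i), (∑ l, Real.exp (δ' l * w) • S l).det = 0 :=
    fun i => exists_zero_of_mul_neg (hab i) (continuous_det_expPencil δ' S).continuousOn (hsign i)
  choose w hwmem hw0 using hzeros
  have hwmono : StrictMono w := by
    intro i j hij
    have h1 := (hwmem i).2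
    have h2 := (hwmem j).1
    have h3 := hdisj i j hij
    linarith
  have hfin' : {t | (∑ l, Real.exp (δ' l * t) • S l).det = 0}.Finite := by
    set α : Equiv.Perm (Fin m) × (Fin m → Fin K) → ℝ :=
      fun p => ((Equiv.Perm.sign p.1 : ℤ) : ℝ) * ∏ i, S (p.2 i) (p.1 i) i with hα
    set s' : Equiv.Perm (Fin m) × (Fin m → Fin K) → ℝ := fun p => ∑ i, δ' (p.2 i) with hs'
    have hG'sum : ∀ t, (∑ l, Real.exp (δ' l * t) • S l).det = ∑ p, α p * Real.exp (s' p * t) :=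
      fun t => det_expPencil_eq_expSum δ' S t
    rcases expSum_zero_or_ncard_le α s' with h | h
    · exfalso
      have h2 := hsign ⟨0, hn⟩
      rw [hG'sum, h, zero_mul] at h2
      exact lt_irrefl 0 h2
    · have : {t | (∑ l, Real.exp (δ' l * t) • S l).det = 0} =
          {t | ∑ p, α p * Real.exp (s' p * t) = 0} := by
        ext t; rw [Set.mem_setOf_eq, Set.mem_setOf_eq, hG'sum]
      rw [this]; exact h.1
  refine ⟨hfin', ?_⟩
  have hsub : Set.range w ⊆ {t | (∑ l, Real.exp (δ' l * t) • S l).det = 0} := by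
    rintro t ⟨i, rfl⟩; exact hw0 i
  have h1 := Set.ncard_le_ncard hsub hfin'
  rw [Set.ncard_range_of_injective hwmono.injective, Nat.card_eq_fintype_card, Fintype.card_fin] at h1
  exact h1

end Brackets

end Summit.ValiantsHypothesis.ValiantsHypothesis.Theorems.LacunarySymmetroidMatrixDescartes.Census.RealExp
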